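import Summits.QuantumFields.YangMills.Theorems.BalabanUVNodesN17AtRecord12Keys
import Summits.QuantumFields.YangMills.Theorems.BalabanUVNodesN17AtRateRecord11
import Summits.QuantumFields.YangMills.Theorems.BalabanUVNodesRateCarriersOfRecord12

/-!
# BalabanUVNodes ∕ node N17 = NE4 AT THE STAGE-12 RATE-RECORD HOME OF RECORD `YMDAG.UVSplit.RRec₁₂ 𝔯` (dag-n22-e (T-RATE) layer B at Stage 12): the K4 stub
# `S_N17 (RRec₁₂ 𝔯)` READ as ONE scale-shift-rate sentence about the continuous-version merged β of the canonical parameter `h.params`, its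
# one-application closers (∀θ estimate ∕ split road ∕ U3 road), and what it delivers ((AF-0r) at every Stage-12 datum key)

Cell `pub-ymgap`, HUMAN RULING D-0062, seat `pub-ymgap-dag-n17-c` (R134 fan-out, strategy s2), generation 3; companion 16 (§53–§54) of `BalabanUVNodesN17Knit` …
`…N17AtRecord12Keys` (companion 15).  THEOREMS ONLY; imports companion 15 (N17 at `IsDatumOfRecord₁₂C` ∕ the level bundles: `N17_iff_betaOfRecord₁₀_params₁₂`,
`n17At_iff_betaOfRecord₁₀_params₁₂`, `n17At_u3Level_iff_params₁₂`, `af0r_params₁₂_of_N17`; hence companion 13's `n17At_datumOfRecord₁₂_iff_merged`), companion 12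
`…N17AtRateRecord11` (the Stage-11 home read — VACUOUS at ₁₁ — for its stage-free `scaleShiftRate_mono_const`), and n22-e's layer B at Stage 12
`…RateCarriersOfRecord12` (`RateReading₁₂` — BOTH readings `lit` ∕ `ne1` TAKE THE PROVISOS —, `u3OfRecord₁₂`, `rateCarriersOfRecord₁₂`, `RRec₁₂`, `s_N17_rRec₁₂_iff`, `S_N18`,
`S_D4`); modifies nothing; every cited lemma used BY NAME.  Stage-12 twin of companion 12 (p457665, §41–§42).

THE POINT.  `RRec₁₂ 𝔯 F D g₀ os R :↔ ∃ (h : Node00.IsDatumOfRecord₁₂C F N D) (k : ℕ), R = rateCarriersOfRecord₁₂ 𝔯 F h.params h.provisos g₀ os k`, and layer B proves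
`s_N17_rRec₁₂_iff : S_N17 (RRec₁₂ 𝔯) ↔ ∀ F D h g₀ os k, N17At D (u3OfRecord₁₂ h.params (𝔯.lit F h.params h.provisos g₀ os).u3 k)`.  Node U3's bundle of run length `k`,
`u3OfRecord₁₂ θ u k = ⟨u.levelCarriers k, Window θ.γ, θ.γ, u.κ, u.EA k, u.EB k, u.θ₅, u.C₅, u.moduli, u.C₉, u.ω, u.cr, u.ρ⟩`, is read by N17 ONLY through the K-uniform
letters `(cr·C₅·θ₅, ρ)` and the window radius `θ.γ` — so `k` drops out (§53 `n17At_u3OfRecord₁₂_iff`, `Iff.rfl`), and at a datum of record the sentence is the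
`ScaleShiftRate` of `betaOfRecord₁₀ h.params.toStage9Params = D.βfun`, equivalently (the window IS the record box) of companion 13's assembly line `βmT(h.params)`:
* §53 `n17At_u3OfRecord₁₂_iff` ∕ `n17At_u3OfRecord₁₂_iff_params` ∕ `n17At_u3OfRecord₁₂_datumOfRecord₁₂_iff`; **`s_N17_rRec₁₂_iff_merged`** (`S_N17 (RRec₁₂ 𝔯)` ⟺ ∀ datum keys,
  `g₀`, `os`: the `βmT(h.params)` rate at the reading's letters on `]0, h.params.γ]`), `s_N17_rRec₁₂_iff_betaOfRecord₁₀`.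
* §54 closers and output: `s_N17_rRec₁₂_of_forall_admissible` (∀θ-with-provisos estimate ⟹ stub), `s_N17_rRec₁₂_of_split` (split road at the printed split of record read
  at the view `θ.toStage11 F N p`: (AF-0r) + remainder rate with `2c₀ + c₁ ≤ cr·C₅·θ₅`), `s_N17_rRec₁₂_of_s_D4_s_N18` (U3 road BY NAME: `YMDAG.N17.s_N17_of_D4_N18`),
  `s_N17_rRec₁₂_of_readOut_ne5_forall_admissible` (U3 road in ∀θ form), `af0r_of_s_N17_rRec₁₂` ((AF-0r) for the one-loop numbers of `h.params` at every key).
HONEST NOTE ON THE CLASS.  `RRec₁₂ 𝔯` ranges over ALL Stage-12 datum keys (no `ZtUnity` guard); the rev-10 items are θ-keyed on print's partition-of-unity class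
(director-ym LINE №99 (2)) — there companion 13's θ-keyed faces and companion 15's guard-generic glue are the sockets; this file serves the `RRec₁₂` home as typed.
NOT VACUOUS at Stage 12 modulo K0′; the readings `𝔯.lit ∕ 𝔯.ne1` RESIDUAL (contentful only for a NAMED reading); every rate input a displayed HYPOTHESIS.

HONEST FRAMING.  Kernel bookkeeping BY NAME; 0 sorry; NE4 NOT IN PRINT ([Balaban1987RG1] (1.20)–(1.22) p. 264) and NOT PROVED; nothing of Bałaban's asserted;
N17 = composite, NOT discharged; «A: n∕28» unmoved.  One finite four-torus at fixed ε per run — NOT infinite volume, NOT OS on ℝ⁴, NOT a mass gap, NOT Clay.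
-/

noncomputable section

open scoped Matrix.Norms.L2Operator

namespace Summit.QuantumFields.YangMills.Theorems.BalabanUVNodesN17

open Literature.MathematicalPhysics.QuantumFieldTheory.Balaban1983to89
open Literature.MathematicalPhysics.QuantumFieldTheory.Balaban1983to89.FlowStep
open Literature.MathematicalPhysics.QuantumFieldTheory.Balaban1983to89.T4CouplingMatching
open Literature.MathematicalPhysics.QuantumFieldTheory.Balaban1983to89.T4Continuum (T4Family FiniteEpsData ULoop)
open Literature.MathematicalPhysics.QuantumFieldTheory.Balaban1983to89.Node00
open Summit.QuantumFields.BalabanUV.T4Continuum.Spine.NE4 (NE4OnData ne4OnData_iff)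
open YMDAG.UVSplit (Datum U3Carriers RateCarriers N17At N18At ReadOutAt S_N17 S_N18 S_D4 RateReading₁₂ RRec₁₂ u3OfRecord₁₂ rateCarriersOfRecord₁₂
  s_N17_rRec₁₂_iff s_N18_rRec₁₂_iff s_D4_rRec₁₂_iff)

variable {F : T4Family} {N : ℕ} [NeZero N]

/-! ## §53 THE STUB `S_N17 (RRec₁₂ 𝔯)` READ: one scale-shift-rate sentence about `βmT(h.params)`, level-free -/

/-- **N17 AT NODE U3's STAGE-12 BUNDLE OF RECORD OF RUN LENGTH `k` DOES NOT READ `k`** (`Iff.rfl`): `N17At D (u3OfRecord₁₂ θ u k) ↔ NE4OnData D (u.cr·u.C₅·u.θ₅) u.ρ θ.γ`.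
[cite: Balaban1987RG1, (1.20)-(1.22) p.264] -/
theorem n17At_u3OfRecord₁₂_iff (D : Datum F N) (θ : Stage12Params F N) (u : U3Objects₁₁) (k : ℕ) :
    N17At D (u3OfRecord₁₂ θ u k) ↔ NE4OnData D (u.cr * u.C₅ * u.θ₅) u.ρ θ.γ := Iff.rfl

/-- **… AT A STAGE-12 DATUM OF RECORD, READ AT ITS CANONICAL PARAMETER**: `N17At D (u3OfRecord₁₂ h.params u k) ↔` the `βmT(h.params)` rate
`ScaleShiftRate (u.cr·u.C₅·u.θ₅) u.ρ h.params.γ …` (companion 15 `n17At_u3Level_iff_params₁₂` at `γ := h.params.γ`). [cite: Balaban1987RG1, (1.20)-(1.22) p.264] -/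
theorem n17At_u3OfRecord₁₂_iff_params {D : Datum F N} (h : IsDatumOfRecord₁₂C F N D) (u : U3Objects₁₁) (k : ℕ) :
    N17At D (u3OfRecord₁₂ h.params u k) ↔
      letI := h.params.instVβ₁; letI := h.params.instVβ₂; letI := h.params.instιβ
      ScaleShiftRate (u.cr * u.C₅ * u.θ₅) u.ρ h.params.γ
        (betaMerged F (mergedTermFamilyMatT F N (TcOfRecord F N) (chiFixed7 F N h.params.ν) h.params.εbg) h.params.ρ8 h.params.bV) :=
  n17At_u3Level_iff_params₁₂ h u le_rfl k

/-- **… AT THE STAGE-12 DATUM OF ANY TUPLE `(θ, hP)`** (the ∀θ currency the estimate seats prove in): `N17At (datumOfRecord₁₂ θ hP) (u3OfRecord₁₂ θ u k) ↔` the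
`βmT(θ)` rate on `]0, θ.γ]` (companion 13 `n17At_datumOfRecord₁₂_iff_merged`). [cite: Balaban1987RG1, (1.20)-(1.22) p.264] -/
theorem n17At_u3OfRecord₁₂_datumOfRecord₁₂_iff (θ : Stage12Params F N) (hP : θ.Provisos₁₂ F N) (u : U3Objects₁₁) (k : ℕ) :
    N17At (datumOfRecord₁₂ F N θ hP) (u3OfRecord₁₂ θ u k) ↔
      letI := θ.instVβ₁; letI := θ.instVβ₂; letI := θ.instιβ
      ScaleShiftRate (u.cr * u.C₅ * u.θ₅) u.ρ θ.γ
        (betaMerged F (mergedTermFamilyMatT F N (TcOfRecord F N) (chiFixed7 F N θ.ν) θ.εbg) θ.ρ8 θ.bV) :=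
  n17At_datumOfRecord₁₂_iff_merged θ hP (u3OfRecord₁₂ θ u k) le_rfl

variable (𝔯 : RateReading₁₂ N)

/-- **THE K4 STUB `S_N17` AT THE STAGE-12 HOME IS ONE SENTENCE ABOUT THE CONTINUOUS-VERSION MERGED β OF THE CANONICAL PARAMETER**: `S_N17 (RRec₁₂ 𝔯)` ⟺ for
every Stage-12 datum of record `D` (canonical parameter `h.params`, provisos `h.provisos`), every bare sequence `g₀` and loop string `os`, the scale-shift rate
`ScaleShiftRate (cr·C₅·θ₅) ρ h.params.γ βmT(h.params)` at the letters of the reading's U3 objects `(𝔯.lit F h.params h.provisos g₀ os).u3` — layer B's `s_N17_rRec₁₂_iff` with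
the run length eliminated (§53's `Iff.rfl`) and the datum read through the key.  NE4 NOT IN PRINT; the reading `𝔯` RESIDUAL. [cite: Balaban1987RG1, (1.20)-(1.22) p.264] -/
theorem s_N17_rRec₁₂_iff_merged :
    S_N17 (RRec₁₂ 𝔯) ↔ ∀ (F : T4Family) (D : Datum F N) (h : IsDatumOfRecord₁₂C F N D) (g₀ : ℕ → ℝ) (os : List (ULoop F)),
      letI := h.params.instVβ₁; letI := h.params.instVβ₂; letI := h.params.instιβ
      ScaleShiftRate
        ((𝔯.lit F h.params h.provisos g₀ os).u3.cr * (𝔯.lit F h.params h.provisos g₀ os).u3.C₅ * (𝔯.lit F h.params h.provisos g₀ os).u3.θ₅)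
        (𝔯.lit F h.params h.provisos g₀ os).u3.ρ h.params.γ
        (betaMerged F (mergedTermFamilyMatT F N (TcOfRecord F N) (chiFixed7 F N h.params.ν) h.params.εbg) h.params.ρ8 h.params.bV) := by
  rw [s_N17_rRec₁₂_iff]
  constructor
  · intro hS F D h g₀ os
    exact (n17At_u3OfRecord₁₂_iff_params h _ 0).mp (hS F D h g₀ os 0)
  · intro hin F D h g₀ os k
    exact (n17At_u3OfRecord₁₂_iff_params h _ k).mpr (hin F D h g₀ os)

/-- **… OR ABOUT THE β OF RECORD ITSELF** (`betaOfRecord₁₀ h.params.toStage9Params = D.βfun`; same window): layer B's face with `k` eliminated and the datum read through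
the key, no box bookkeeping (companion 15 `n17At_iff_betaOfRecord₁₀_params₁₂`). [cite: Balaban1987RG1, (1.20)-(1.22) p.264] -/
theorem s_N17_rRec₁₂_iff_betaOfRecord₁₀ :
    S_N17 (RRec₁₂ 𝔯) ↔ ∀ (F : T4Family) (D : Datum F N) (h : IsDatumOfRecord₁₂C F N D) (g₀ : ℕ → ℝ) (os : List (ULoop F)),
      ScaleShiftRate
        ((𝔯.lit F h.params h.provisos g₀ os).u3.cr * (𝔯.lit F h.params h.provisos g₀ os).u3.C₅ * (𝔯.lit F h.params h.provisos g₀ os).u3.θ₅)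
        (𝔯.lit F h.params h.provisos g₀ os).u3.ρ h.params.γ (betaOfRecord₁₀ F N h.params.toStage9Params) := by
  rw [s_N17_rRec₁₂_iff]
  constructor
  · intro hS F D h g₀ os
    exact (n17At_iff_betaOfRecord₁₀_params₁₂ h _).mp (hS F D h g₀ os 0)
  · intro hin F D h g₀ os k
    exact (n17At_iff_betaOfRecord₁₀_params₁₂ h _).mpr (hin F D h g₀ os)

/-! ## §54 THE ONE-APPLICATION CLOSERS OF `S_N17 (RRec₁₂ 𝔯)` AND WHAT IT DELIVERS -/

/-- **THE ONE-APPLICATION CLOSER (∀θ estimate ⟹ the stub at the Stage-12 home)**: if for EVERY admissible Stage-12 parameter `θ` with provisos `hP`, every `g₀, os`, the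
continuous-version merged β `βmT(θ)` has the scale-shift rate `ScaleShiftRate (cr·C₅·θ₅) ρ θ.γ βmT(θ)` at the letters of `(𝔯.lit F θ hP g₀ os).u3` — the shape an estimate seat
proves, NE4 = rows NE2 ∕ NE3 ∕ (D4) composed (NOT IN PRINT) — then `S_N17 (RRec₁₂ 𝔯)` (instantiate at the canonical parameter of each datum key).
[cite: Balaban1987RG1, (1.20)-(1.22) p.264] -/
theorem s_N17_rRec₁₂_of_forall_admissible
    (hin : ∀ (F : T4Family) (θ : Stage12Params F N) (hP : θ.Provisos₁₂ F N), θ.Admissible F N → ∀ (g₀ : ℕ → ℝ) (os : List (ULoop F)),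
      letI := θ.instVβ₁; letI := θ.instVβ₂; letI := θ.instιβ
      ScaleShiftRate ((𝔯.lit F θ hP g₀ os).u3.cr * (𝔯.lit F θ hP g₀ os).u3.C₅ * (𝔯.lit F θ hP g₀ os).u3.θ₅) (𝔯.lit F θ hP g₀ os).u3.ρ θ.γ
        (betaMerged F (mergedTermFamilyMatT F N (TcOfRecord F N) (chiFixed7 F N θ.ν) θ.εbg) θ.ρ8 θ.bV)) :
    S_N17 (RRec₁₂ 𝔯) :=
  (s_N17_rRec₁₂_iff_merged 𝔯).mpr fun F _ h g₀ os => hin F h.params h.provisos h.admissible g₀ os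

/-- **THE SPLIT ROAD AT THE STAGE-12 HOME** («β⁰ conv + β¹ shift» through the printed split of record READ AT THE VIEW `θ.toStage11 F N p`, any run `p` — companion 14):
if for every admissible `θ` with provisos `hP`, every `g₀, os`, the letters `u := (𝔯.lit F θ hP g₀ os).u3` have `0 ≤ u.ρ ≤ 1` and there are a run `p` and constants `c₀ ≥ 0`,
`c₁` with `2c₀ + c₁ ≤ u.cr·u.C₅·u.θ₅`, (AF-0r) `|beta0OfRecord₁₁ (θ.toStage11 p) k − β⁰_∞| ≤ c₀·u.ρ^k` (N15 ∕ NODE O currency) and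
`RemainderShiftRate (oneLoopSplitOfRecord₁₁ (θ.toStage11 p)) c₁ u.ρ θ.γ` (N16 ∕ N18), then `S_N17 (RRec₁₂ 𝔯)` (`T4CouplingMatching.scaleShiftRate_of_split` at the split of
record, monotonicity in the constant).  Both binders UNPRINTED, displayed. [cite: Balaban1987RG1, (2.12)-(2.14) p.268] -/
theorem s_N17_rRec₁₂_of_split
    (hin : ∀ (F : T4Family) (θ : Stage12Params F N) (hP : θ.Provisos₁₂ F N), θ.Admissible F N → ∀ (g₀ : ℕ → ℝ) (os : List (ULoop F)),
      0 ≤ (𝔯.lit F θ hP g₀ os).u3.ρ ∧ (𝔯.lit F θ hP g₀ os).u3.ρ ≤ 1 ∧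
      ∃ (p : B12.RunParams) (binf c₀ c₁ : ℝ), 0 ≤ c₀ ∧
        2 * c₀ + c₁ ≤ (𝔯.lit F θ hP g₀ os).u3.cr * (𝔯.lit F θ hP g₀ os).u3.C₅ * (𝔯.lit F θ hP g₀ os).u3.θ₅ ∧
        (∀ k, |beta0OfRecord₁₁ F N (θ.toStage11 F N p) k - binf| ≤ c₀ * (𝔯.lit F θ hP g₀ os).u3.ρ ^ k) ∧
        RemainderShiftRate (oneLoopSplitOfRecord₁₁ F N (θ.toStage11 F N p)) c₁ (𝔯.lit F θ hP g₀ os).u3.ρ θ.γ) :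
    S_N17 (RRec₁₂ 𝔯) := by
  rw [s_N17_rRec₁₂_iff]
  intro F D h g₀ os k
  obtain ⟨hρ0, hρ1, p, binf, c₀, c₁, hc₀, hcc, hconv, hrem⟩ := hin F h.params h.provisos h.admissible g₀ os
  rw [n17At_u3OfRecord₁₂_iff, N17_iff_betaOfRecord₁₀_params₁₂ h]
  exact scaleShiftRate_mono_const hcc hρ0
    (scaleShiftRate_of_split (oneLoopSplitOfRecord₁₁ F N (h.params.toStage11 F N p)) hρ0 hρ1 hc₀ hconv hrem)

/-- **THE U3 ROAD AT THE STAGE-12 HOME, BY NAME**: `S_D4 (RRec₁₂ 𝔯) → S_N18 (RRec₁₂ 𝔯) → S_N17 (RRec₁₂ 𝔯)` — companion `…N17AtSpineCarriers`' refinement-generic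
`YMDAG.N17.s_N17_of_D4_N18` at the home (N22 idle); recorded so a K4 skeleton at `RRec₁₂ 𝔯` can quote N17 as GLUE. [cite: Balaban1987RG1, (1.20)-(1.22) p.264] -/
theorem s_N17_rRec₁₂_of_s_D4_s_N18 (hD4 : S_D4 (RRec₁₂ 𝔯)) (h18 : S_N18 (RRec₁₂ 𝔯)) : S_N17 (RRec₁₂ 𝔯) :=
  YMDAG.N17.s_N17_of_D4_N18 (RRec₁₂ 𝔯) hD4 h18

/-- **THE U3 ROAD IN ∀θ FORM AT THE STAGE-12 BUNDLES OF RECORD**: the (D4) read-out binders at `(datumOfRecord₁₂ θ hP, u3OfRecord₁₂ θ (𝔯.lit F θ hP g₀ os).u3 k)` and NE5 at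
`u3OfRecord₁₂ θ (𝔯.lit F θ hP g₀ os).u3 k`, for every admissible `θ` with provisos, every `g₀, os, k` ⟹ `S_N17 (RRec₁₂ 𝔯)` (pointwise `YMDAG.N17.n17At_of_readOutAt`, then layer B's
`s_N17_rRec₁₂_iff` at the canonical parameters).  (D4) and NE5 UNPRINTED — binders. [cite: Balaban1987RG1, (1.20)-(1.22) p.264] -/
theorem s_N17_rRec₁₂_of_readOut_ne5_forall_admissible
    (hD4 : ∀ (F : T4Family) (θ : Stage12Params F N) (hP : θ.Provisos₁₂ F N), θ.Admissible F N → ∀ (g₀ : ℕ → ℝ) (os : List (ULoop F)) (k : ℕ),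
      ReadOutAt (datumOfRecord₁₂ F N θ hP) (u3OfRecord₁₂ θ (𝔯.lit F θ hP g₀ os).u3 k))
    (h18 : ∀ (F : T4Family) (θ : Stage12Params F N) (hP : θ.Provisos₁₂ F N), θ.Admissible F N → ∀ (g₀ : ℕ → ℝ) (os : List (ULoop F)) (k : ℕ),
      N18At (u3OfRecord₁₂ θ (𝔯.lit F θ hP g₀ os).u3 k)) :
    S_N17 (RRec₁₂ 𝔯) := by
  rw [s_N17_rRec₁₂_iff]
  intro F D h g₀ os k
  have h17 := YMDAG.N17.n17At_of_readOutAt _ (hD4 F h.params h.provisos h.admissible g₀ os k)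
    (h18 F h.params h.provisos h.admissible g₀ os k)
  rwa [← h.eq_datumOfRecord₁₂] at h17

/-- **WHAT THE STUB AT THE STAGE-12 HOME DELIVERS: (AF-0r) FOR THE ONE-LOOP NUMBERS OF RECORD AT EVERY DATUM KEY.**  `S_N17 (RRec₁₂ 𝔯)`, a Stage-12 datum of record `D`
with canonical parameter `θ := h.params`, `g₀, os` with letters `u := (𝔯.lit F θ h.provisos g₀ os).u3` satisfying `u.ρ < 1`, and the definer's one-sided limit
`Beta0LimitExists βmT(θ) θ.v₀` at COHERENT reference histories with entries in `]0, θ.γ]` ⟹ `∃ β⁰_∞, |beta0OfMerged βmT(θ) θ.v₀ k − β⁰_∞| ≤ (u.cr·u.C₅·u.θ₅ ∕ (1 − u.ρ))·u.ρ^k`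
— the `hconv` input of K2′'s engine at the split of record, SUPPLIED by the node (companion 15 `af0r_params₁₂_of_N17`). [cite: Balaban1987RG1, (2.12)-(2.14) p.268] -/
theorem af0r_of_s_N17_rRec₁₂ (hS : S_N17 (RRec₁₂ 𝔯)) {F : T4Family} {D : Datum F N} (h : IsDatumOfRecord₁₂C F N D) (g₀ : ℕ → ℝ)
    (os : List (ULoop F)) (hρ1 : (𝔯.lit F h.params h.provisos g₀ os).u3.ρ < 1)
    (hlim : letI := h.params.instVβ₁; letI := h.params.instVβ₂; letI := h.params.instιβ
      Beta0LimitExists (betaMerged F (mergedTermFamilyMatT F N (TcOfRecord F N) (chiFixed7 F N h.params.ν) h.params.εbg) h.params.ρ8 h.params.bV)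
        h.params.v₀)
    (hcoh : ∀ k, Fin.tail (h.params.v₀ (k + 1)) = h.params.v₀ k) (hadm : ∀ k i, 0 < h.params.v₀ k i ∧ h.params.v₀ k i ≤ h.params.γ) :
    letI := h.params.instVβ₁; letI := h.params.instVβ₂; letI := h.params.instιβ
    ∃ binf : ℝ, ∀ k,
      |beta0OfMerged (betaMerged F (mergedTermFamilyMatT F N (TcOfRecord F N) (chiFixed7 F N h.params.ν) h.params.εbg) h.params.ρ8 h.params.bV)
          h.params.v₀ k - binf| ≤
        (𝔯.lit F h.params h.provisos g₀ os).u3.cr * (𝔯.lit F h.params h.provisos g₀ os).u3.C₅ * (𝔯.lit F h.params h.provisos g₀ os).u3.θ₅ /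
          (1 - (𝔯.lit F h.params h.provisos g₀ os).u3.ρ) * (𝔯.lit F h.params h.provisos g₀ os).u3.ρ ^ k := by
  letI := h.params.instVβ₁; letI := h.params.instVβ₂; letI := h.params.instιβ
  exact af0r_params₁₂_of_N17 h le_rfl h.gamma_pos hρ1 hlim hcoh hadm
    ((n17At_u3OfRecord₁₂_iff D h.params _ 0).mp ((s_N17_rRec₁₂_iff 𝔯).mp hS F D h g₀ os 0))

end Summit.QuantumFields.YangMills.Theorems.BalabanUVNodesN17

end
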